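import Literature.Topology.PlanarFoliations.Regions
import Literature.Topology.PlanarFoliations.VanishingBand
import HarnessLib

/-!
# A region of image-null closed leaves with a closed frontier leaf yields a vanishing cycle

Topic: Topology / PlanarFoliations, sequel to `Regions.lean`, `VanishingBand.lean`. The
graph-free half of Camacho–Lins Neto, *Geometric Theory of Foliations*, Ch. VII §2 Prop. 1: let
`W` be a connected component of the open set `V` of points with image-null compact leaf (open,
saturated, preconnected, maximal among preconnected subsets of `V`), inside a compact part of
the region, and suppose that **some frontier leaf `E` of `W` is compact**. Then

* `E` is **not image-null** (otherwise a connected neighbourhood of a point of `E` inside the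
  open `V` meets `W`, hence lies in `W` by maximality — but `E ⊆ ∂W` misses the open `W`);
* `W` contains a **one-sided band at `E`** (`exists_Ioo_subset_of_mem_frontier`);
* hence the injective leaf loop of `E`, based at the chosen point, with essential image and an
  adjacent band of image-null leaves, gives **a vanishing cycle of `T`**
  (`exists_vanishingCycle`): "if `∂Vᵢ` is a closed orbit `γ₀` then `g(γ₀)` is not homotopic to
  a constant … and we are done".

* `PunctureData.not_imageNull_of_mem_frontier` (**proved**).
* `PunctureData.exists_vanishingCycle_of_mem_frontier` (**proved**).

The remaining case — every frontier leaf of every component of `V` a separatrix (`∂Vᵢ` a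
graph for all `i`) — is the merging argument of loc. cit., not treated here.
-/

noncomputable section

open Set Filter Function Bornology Metric
open _root_.Topology unitInterval
open Literature.Topology.FourManifolds Literature.Topology.FourManifolds.Foliation
  Literature.Topology.FourManifolds.OneManifold Literature.Topology.PlaneTopology

namespace Literature.Topology.PlanarFoliations

variable {X : Type*} [TopologicalSpace X] [T2Space X] [SecondCountableTopology X] {F : Foliation ℝ X}
variable {ι : X → ℂ} {e : OpenPartialHomeomorph X (ℝ × ℝ)}
variable {B : Type*} [NormedAddCommGroup B] [NormedSpace ℝ B] [LocallyConnectedSpace B] {M : Type*} [TopologicalSpace M]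
  {T : Foliation B M} {g : ℂ → M}

namespace PunctureData

variable (D : PunctureData F ι T g)

/-- **A frontier point of a component of `V` is not image-null.** [folklore] -/
theorem not_imageNull_of_mem_frontier (hbi : IsBiOriented F) (hι : IsOpenEmbedding ι) (ho : F.IsTransverselyOriented) {W : Set X}
    (hWo : IsOpen W) (hWmax : ∀ S : Set X, IsPreconnected S → (∀ z ∈ S, ImageNull D.foliated z) → (S ∩ W).Nonempty → S ⊆ W)
    {y : X} (hy : y ∈ frontier W) : ¬ ImageNull D.foliated y := by
  intro hIN
  haveI : LocallyConnectedSpace X := hι.locallyConnectedSpace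
  set V : Set X := {z | ImageNull D.foliated z} with hV
  have hVo : IsOpen V := isOpen_setOf_imageNull hbi D.foliated ho
  set S := connectedComponentIn V y with hS
  have hSo : IsOpen S := hVo.connectedComponentIn
  have hyS : y ∈ S := mem_connectedComponentIn hIN
  have hyW : y ∉ W := by have h := hy; rw [hWo.frontier_eq] at h; exact h.2
  have hycl : y ∈ closure W := by have h := hy; rw [hWo.frontier_eq] at h; exact h.1
  obtain ⟨w, hwS, hwW⟩ := mem_closure_iff_nhds.1 hycl S (hSo.mem_nhds hyS)
  have hSV : ∀ z ∈ S, ImageNull D.foliated z := fun z hz ↦ (connectedComponentIn_subset V y hz : z ∈ V)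
  exact hyW (hWmax S isPreconnected_connectedComponentIn hSV ⟨w, hwS, hwW⟩ hyS)

/-- **A component of the region of image-null closed leaves with a compact frontier leaf yields a
vanishing cycle** (Camacho–Lins Neto, Ch. VII §2 Prop. 1, the case "`∂Vᵢ` is a closed orbit").
[cite: CamachoLinsNeto1985, Ch. VII §2 Prop. 1] -/
theorem exists_vanishingCycle_of_mem_frontier (hbi : IsBiOriented F) (hι : IsOpenEmbedding ι)
    (ho : F.IsTransverselyOriented) {W : Set X} (hWo : IsOpen W) (hWsat : F.IsSaturated W) (hWconn : IsPreconnected W)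
    (hWV : ∀ w ∈ W, ImageNull D.foliated w)
    (hWmax : ∀ S : Set X, IsPreconnected S → (∀ z ∈ S, ImageNull D.foliated z) → (S ∩ W).Nonempty → S ⊆ W)
    {C : Set ℂ} (hC : IsCompact C) (hCΩ : C ⊆ D.Ω) (hWC : ∀ z ∈ closure W, ι z ∈ C) {y : X} (hy : y ∈ frontier W)
    (hK : IsCompact (F.leaf y)) :
    ∃ Cv : T.VanishingCycle, ∀ θ, Cv.fam 0 θ ∈ (g ∘ ι) '' F.leaf y := by
  have hnotIN := D.not_imageNull_of_mem_frontier hbi hι ho hWo hWmax hy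
  -- the injective leaf loop of `E`, based at `y`
  obtain ⟨γ₀, hc₀, hp₀, hinj₀, hsurj₀⟩ := exists_leafLoop_of_isCompact (x := y) hbi hK
  set py : F.Leaf y := ⟨toLeafSpace y, F.mem_leaf_self y⟩ with hpy
  obtain ⟨s₁, hs₁⟩ : py ∈ range γ₀ := by rw [hsurj₀]; exact mem_univ _
  obtain ⟨hc, hp, hinj, hsurj⟩ := CircleLoops.rebase hc₀ hp₀ hinj₀ hsurj₀ s₁
  set γ : ℝ → F.Leaf y := fun s ↦ γ₀ (s + s₁) with hγ
  have hbase : loopBase γ = y := by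
    show ofLeafSpace ((γ₀ (0 + s₁) : F.Leaf y) : F.LeafSpace) = y
    rw [zero_add, hs₁]
    rfl
  -- a flow box at `y`
  obtain ⟨e, he, hye⟩ := F.exists_mem_source y
  have hx₀ : loopBase γ ∈ e.source := by rw [hbase]; exact hye
  have hcoord : baseCoord γ e = (e y).1 := by rw [baseCoord_def, hbase]
  have hlevel : baseLevel γ e = (e y).2 := by rw [baseLevel_def, hbase]
  -- essential image
  have hess : ¬ ((F.leafLoop (loopPath γ hc hp) (continuous_toLeafSpace_loopPath γ hc hp)).map
      D.foliated.continuous_leafMap).Homotopic (Path.refl _) := fun hnull ↦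
    hnotIN ⟨y, γ, hc, hp, F.mem_leaf_self y, hinj, hsurj, hnull⟩
  -- the one-sided band
  obtain ⟨δ, hδ, hband⟩ := D.exists_Ioo_subset_of_mem_frontier hbi hι hWo hWsat hWconn hWV hC hCΩ hWC hy hK he hye
  have hvert : ∀ t : ℝ, vert γ e t = e.symm ((e y).1, t) := fun t ↦ by rw [vert_def, hcoord]
  rcases hband with hup | hdown
  · obtain ⟨Cv, hCv⟩ := exists_vanishingCycle hbi hι ho D.foliated hc hp he hx₀ hess (Or.inl rfl) hδ fun t ht ↦ by
      rw [hvert, hlevel, one_mul]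
      exact hWV _ (hup _ ⟨by linarith [ht.1], by linarith [ht.2]⟩)
    exact ⟨Cv, fun θ ↦ ⟨loopPath γ hc hp θ, loopPath_mem_leaf γ hc hp θ, (hCv θ).symm⟩⟩
  · obtain ⟨Cv, hCv⟩ := exists_vanishingCycle hbi hι ho D.foliated hc hp he hx₀ hess (Or.inr rfl) hδ fun t ht ↦ by
      rw [hvert, hlevel, neg_one_mul]
      exact hWV _ (hdown _ ⟨by linarith [ht.2], by linarith [ht.1]⟩)
    exact ⟨Cv, fun θ ↦ ⟨loopPath γ hc hp θ, loopPath_mem_leaf γ hc hp θ, (hCv θ).symm⟩⟩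

end PunctureData

end Literature.Topology.PlanarFoliations
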